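import Mathlib.Tactic.Ring
import Mathlib.Tactic.LinearCombination
import Mathlib.Data.Real.Basic
import HarnessLib

/-!
# The charge-zero lemma: Step 1–2 identities of the proof of Lemma N₂′, kernel-checked in format (6,4)

Fifth file of the charge-zero lemma (prover 2, generation 8, hodge-weil ladder cell; note
`b2b-hweil-pv2-g8/CHARGE-ZERO-LEMMA.md` §4). The general-`n` part of the proof (Theorem 1) is in
`WeilClassTestChargeZeroLemmaGeneral.lean`; what connects the ORIGINAL statement (Lemma N₂′: centring + (P1) + (P3) +
N-dominance ⟹ `Q₂ > 0`) to Theorem 1 are two identities (Steps 1–2 of §4), checked here by `linear_combination` in the format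
`(e,f) = (6,4)` of the ladder's designs (they are format-independent manipulations of finite sums; `(6,4)` is the anchor the
referee asked for). With `s` a real parameter (in the proof: `s = max_F A`), `b_i = A_i − s`, `d_j = s − B_j`, `T = −2s`:
* `stepOne_64` — MULTIPLIER IDENTITY: centring `ΣA = ΣB` and (P3) `ΣA_iu_i² = ΣB_jv_j²` give
  `T·Q₂ = (Σb² − Σd² + T²)·W + T·(ΣAu − ΣBv)² − 3T·M₂` with `W = Σb_iu_i² + Σd_jv_j²`, `M₂ = Σb_i²u_i² − Σd_j²v_j²` — this is
  `Q₂ = κW + L₁² − 3M₂` of the note (`κ = (Σb² − Σd² + T²)/T`), i.e. the choice of the (P3)-multiplier whose lower root is `s`.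
* `stepTwo_64` — HYPERPLANE IDENTITY: centring of the charges `Σu = Σv` and (P1) `ΣA²u = ΣB²v` give
  `Σ_i b_i²u_i − Σ_j d_j²v_j = T·(Σ_i b_iu_i + Σ_j d_jv_j)`, i.e. `Σ x_k²z_k = T Σ x_kz_k` in the note's notation — the
  hyperplane `Σ (T − x_k)h_k = 0` on which Theorem 1 is applied.
Nothing here is a rung or a fact; pure algebra. [cite: PolikTerlaky2007, §2 (S-lemma multipliers)]
-/

namespace Literature.AlgebraicGeometry.HodgeTheory.WeilClassTestChargeZeroLemma

/-- STEP 1 (format (6,4)): the multiplier identity `T·Q₂ = (Σb² − Σd² + T²)W + T·L² − 3T·M₂` under centring and (P3).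
[cite: PolikTerlaky2007, §2] -/
theorem stepOne_64 (A₁ A₂ A₃ A₄ A₅ A₆ B₁ B₂ B₃ B₄ u₁ u₂ u₃ u₄ u₅ u₆ v₁ v₂ v₃ v₄ s : ℝ)
    (hA : A₁ + A₂ + A₃ + A₄ + A₅ + A₆ = B₁ + B₂ + B₃ + B₄)
    (hP3 : A₁ * u₁ ^ 2 + A₂ * u₂ ^ 2 + A₃ * u₃ ^ 2 + A₄ * u₄ ^ 2 + A₅ * u₅ ^ 2 + A₆ * u₆ ^ 2
      = B₁ * v₁ ^ 2 + B₂ * v₂ ^ 2 + B₃ * v₃ ^ 2 + B₄ * v₄ ^ 2) :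
    (-2 * s) * ((1 / 2) * ((A₁ ^ 2 + A₂ ^ 2 + A₃ ^ 2 + A₄ ^ 2 + A₅ ^ 2 + A₆ ^ 2) - (B₁ ^ 2 + B₂ ^ 2 + B₃ ^ 2 + B₄ ^ 2))
          * ((u₁ ^ 2 + u₂ ^ 2 + u₃ ^ 2 + u₄ ^ 2 + u₅ ^ 2 + u₆ ^ 2) - (v₁ ^ 2 + v₂ ^ 2 + v₃ ^ 2 + v₄ ^ 2))
        + ((A₁ * u₁ + A₂ * u₂ + A₃ * u₃ + A₄ * u₄ + A₅ * u₅ + A₆ * u₆) - (B₁ * v₁ + B₂ * v₂ + B₃ * v₃ + B₄ * v₄)) ^ 2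
        - 3 * ((A₁ ^ 2 * u₁ ^ 2 + A₂ ^ 2 * u₂ ^ 2 + A₃ ^ 2 * u₃ ^ 2 + A₄ ^ 2 * u₄ ^ 2 + A₅ ^ 2 * u₅ ^ 2 + A₆ ^ 2 * u₆ ^ 2)
          - (B₁ ^ 2 * v₁ ^ 2 + B₂ ^ 2 * v₂ ^ 2 + B₃ ^ 2 * v₃ ^ 2 + B₄ ^ 2 * v₄ ^ 2)))
      = (((A₁ - s) ^ 2 + (A₂ - s) ^ 2 + (A₃ - s) ^ 2 + (A₄ - s) ^ 2 + (A₅ - s) ^ 2 + (A₆ - s) ^ 2)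
            - ((s - B₁) ^ 2 + (s - B₂) ^ 2 + (s - B₃) ^ 2 + (s - B₄) ^ 2) + (-2 * s) ^ 2)
          * (((A₁ - s) * u₁ ^ 2 + (A₂ - s) * u₂ ^ 2 + (A₃ - s) * u₃ ^ 2 + (A₄ - s) * u₄ ^ 2 + (A₅ - s) * u₅ ^ 2
              + (A₆ - s) * u₆ ^ 2) + ((s - B₁) * v₁ ^ 2 + (s - B₂) * v₂ ^ 2 + (s - B₃) * v₃ ^ 2 + (s - B₄) * v₄ ^ 2))
        + (-2 * s) * ((A₁ * u₁ + A₂ * u₂ + A₃ * u₃ + A₄ * u₄ + A₅ * u₅ + A₆ * u₆) - (B₁ * v₁ + B₂ * v₂ + B₃ * v₃ + B₄ * v₄)) ^ 2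
        - 3 * (-2 * s) * (((A₁ - s) ^ 2 * u₁ ^ 2 + (A₂ - s) ^ 2 * u₂ ^ 2 + (A₃ - s) ^ 2 * u₃ ^ 2 + (A₄ - s) ^ 2 * u₄ ^ 2
              + (A₅ - s) ^ 2 * u₅ ^ 2 + (A₆ - s) ^ 2 * u₆ ^ 2)
            - ((s - B₁) ^ 2 * v₁ ^ 2 + (s - B₂) ^ 2 * v₂ ^ 2 + (s - B₃) ^ 2 * v₃ ^ 2 + (s - B₄) ^ 2 * v₄ ^ 2)) := by
  linear_combination (-(((A₁ ^ 2 + A₂ ^ 2 + A₃ ^ 2 + A₄ ^ 2 + A₅ ^ 2 + A₆ ^ 2) - (B₁ ^ 2 + B₂ ^ 2 + B₃ ^ 2 + B₄ ^ 2))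
        - 6 * s ^ 2 - 2 * s * ((A₁ + A₂ + A₃ + A₄ + A₅ + A₆) - (B₁ + B₂ + B₃ + B₄)))) * hP3
    + (-(2 * s ^ 2 * ((u₁ ^ 2 + u₂ ^ 2 + u₃ ^ 2 + u₄ ^ 2 + u₅ ^ 2 + u₆ ^ 2) - (v₁ ^ 2 + v₂ ^ 2 + v₃ ^ 2 + v₄ ^ 2)))) * hA

/-- STEP 2 (format (6,4)): the hyperplane identity `Σb²u − Σd²v = T(Σbu + Σdv)` under centring of the charges and (P1).
[folklore] -/
theorem stepTwo_64 (A₁ A₂ A₃ A₄ A₅ A₆ B₁ B₂ B₃ B₄ u₁ u₂ u₃ u₄ u₅ u₆ v₁ v₂ v₃ v₄ s : ℝ)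
    (hC : u₁ + u₂ + u₃ + u₄ + u₅ + u₆ = v₁ + v₂ + v₃ + v₄)
    (hP1 : A₁ ^ 2 * u₁ + A₂ ^ 2 * u₂ + A₃ ^ 2 * u₃ + A₄ ^ 2 * u₄ + A₅ ^ 2 * u₅ + A₆ ^ 2 * u₆
      = B₁ ^ 2 * v₁ + B₂ ^ 2 * v₂ + B₃ ^ 2 * v₃ + B₄ ^ 2 * v₄) :
    ((A₁ - s) ^ 2 * u₁ + (A₂ - s) ^ 2 * u₂ + (A₃ - s) ^ 2 * u₃ + (A₄ - s) ^ 2 * u₄ + (A₅ - s) ^ 2 * u₅ + (A₆ - s) ^ 2 * u₆)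
        - ((s - B₁) ^ 2 * v₁ + (s - B₂) ^ 2 * v₂ + (s - B₃) ^ 2 * v₃ + (s - B₄) ^ 2 * v₄)
      = (-2 * s) * (((A₁ - s) * u₁ + (A₂ - s) * u₂ + (A₃ - s) * u₃ + (A₄ - s) * u₄ + (A₅ - s) * u₅ + (A₆ - s) * u₆)
          + ((s - B₁) * v₁ + (s - B₂) * v₂ + (s - B₃) * v₃ + (s - B₄) * v₄)) := by
  linear_combination hP1 - s ^ 2 * hC

end Literature.AlgebraicGeometry.HodgeTheory.WeilClassTestChargeZeroLemma
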